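import Mathlib
import Summits.Ventures.HodgeRepro2.T5SchurTensor

/-!
# `Hom_R(N, N ⊗ W) = W` under Schur (the multiplicity space as a Hom space)

Blind cell `pub-hodge-repro2`, seat p8 (gen 5), Tier-5 kernel support.  Throughout the N3 record
(route/T5-N3-route-2.md §N3.10.3 / §N3.12.4; Howe 1989 Thm 2.1's «`𝒫/𝒩_ρ ≅ ρ ⊗ ρ′₁`», MVW III.3's
«`S[π₁] ≅ π₁ ⊗ V₂′`») the second tensor factor is recovered as a space of maps out of the
irreducible first factor: `Hom_{G₁}(π₁, π₁ ⊗ V₂′) = V₂′`.  This file kernel-checks that identity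
in the abstract, as a corollary of `T5SchurTensor` (p391579):

  for a `k`-algebra `S`, an `S`-module `M` with `End_S(M) = k` (Schur) and `M ≠ 0`, and a
  `k`-space `W` (with `S` acting on `M ⊗[k] W` through `M`), every `S`-linear map
  `ψ : M → M ⊗[k] W` is `m ↦ m ⊗ w` for a unique `w ∈ W`; `w ↦ (m ↦ m ⊗ w)` is a `k`-linear
  equivalence `W ≃ₗ[k] (M →ₗ[S] M ⊗[k] W)` (`homTensorEquiv`).

Proof: `ψ ∘ rid⁻¹ : M ⊗[k] k → M ⊗[k] W` is `S`-linear, hence `1 ⊗ t` for a `k`-linear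
`t : k → W` (`T5SchurTensor.exists_linear`), so `ψ m = m ⊗ t 1`; uniqueness by injectivity of
`w ↦ m₀ ⊗ w` (`T5SchurTensor.tmul_right_injective'`).  The Schur hypothesis is supplied by
`T5DixmierSchur` / `T5SchurEigenvalue` / `T5SchurIsotypicComponent` for the record's `ρ`.

README §8(d): uses an L-value-free non-vanishing device: NO.
-/

noncomputable section

namespace Summit.Ventures.HodgeRepro2.T5HomTensor

open TensorProduct
open Summit.Ventures.HodgeRepro2.T5SchurTensor

variable {k S : Type*} [Field k] [Ring S] [Algebra k S] {M : Type*} [AddCommGroup M] [Module k M]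
  [Module S M] [IsScalarTower k S M] {W : Type*} [AddCommGroup W] [Module k W]

/-- **Every `S`-linear `M → M ⊗ W` is `m ↦ m ⊗ w`** (Schur for `M`). -/
theorem exists_tmul_eq (hSchur : ∀ φ : M →ₗ[S] M, ∃ c : k, ∀ x, φ x = c • x)
    [Nontrivial M] (ψ : M →ₗ[S] M ⊗[k] W) : ∃ w : W, ∀ m, ψ m = m ⊗ₜ[k] w := by
  -- `Φ := ψ ∘ rid : M ⊗[k] k → M ⊗[k] W` is `S`-linear, hence `1 ⊗ t`
  let Φ : M ⊗[k] k →ₗ[S] M ⊗[k] W :=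
    ψ ∘ₗ (TensorProduct.AlgebraTensorModule.rid k S M).toLinearMap
  obtain ⟨t, ht⟩ := exists_linear hSchur Φ
  refine ⟨t 1, fun m => ?_⟩
  have h := ht m 1
  simp only [Φ, LinearMap.comp_apply, LinearEquiv.coe_coe,
    TensorProduct.AlgebraTensorModule.rid_tmul, one_smul] at h
  exact h

/-- The `w` is unique. -/
theorem tmul_eq_unique [Nontrivial M] {w w' : W} (h : ∀ m : M, m ⊗ₜ[k] w = m ⊗ₜ[k] w') : w = w' := by
  obtain ⟨m₀, hm₀⟩ := exists_ne (0 : M)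
  exact tmul_right_injective' (k := k) hm₀ (h m₀)

/-- The chosen `w` with `ψ m = m ⊗ w`. -/
def coeff (hSchur : ∀ φ : M →ₗ[S] M, ∃ c : k, ∀ x, φ x = c • x) [Nontrivial M]
    (ψ : M →ₗ[S] M ⊗[k] W) : W :=
  Classical.choose (exists_tmul_eq hSchur ψ)

/-- `ψ m = m ⊗ coeff ψ`. -/
theorem coeff_spec (hSchur : ∀ φ : M →ₗ[S] M, ∃ c : k, ∀ x, φ x = c • x) [Nontrivial M]
    (ψ : M →ₗ[S] M ⊗[k] W) (m : M) : ψ m = m ⊗ₜ[k] coeff hSchur ψ :=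
  Classical.choose_spec (exists_tmul_eq hSchur ψ) m

/-- `coeff (m ↦ m ⊗ w) = w`. -/
theorem coeff_tmulRight (hSchur : ∀ φ : M →ₗ[S] M, ∃ c : k, ∀ x, φ x = c • x) [Nontrivial M]
    (w : W) : coeff hSchur (tmulRight (k := k) (S := S) (M := M) w) = w :=
  tmul_eq_unique fun m => (coeff_spec hSchur (tmulRight w) m).symm.trans (tmulRight_apply w m)

/-- **`Hom_S(M, M ⊗ W) ≃ W`.** Under Schur for `M ≠ 0`, `w ↦ (m ↦ m ⊗ w)` is a `k`-linear
equivalence `W ≃ₗ[k] (M →ₗ[S] M ⊗[k] W)`, with inverse `coeff`. -/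
def homTensorEquiv (hSchur : ∀ φ : M →ₗ[S] M, ∃ c : k, ∀ x, φ x = c • x) [Nontrivial M] :
    W ≃ₗ[k] (M →ₗ[S] M ⊗[k] W) where
  toFun w := tmulRight w
  invFun := coeff hSchur
  left_inv := coeff_tmulRight hSchur
  right_inv ψ := LinearMap.ext fun m => by
    rw [tmulRight_apply, coeff_spec hSchur ψ m]
  map_add' w w' := LinearMap.ext fun m => by
    simp only [LinearMap.add_apply, tmulRight_apply, tmul_add]
  map_smul' c w := LinearMap.ext fun m => by
    simp only [LinearMap.smul_apply, tmulRight_apply, RingHom.id_apply, tmul_smul]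

/-- `homTensorEquiv w m = m ⊗ w`. -/
@[simp] theorem homTensorEquiv_apply (hSchur : ∀ φ : M →ₗ[S] M, ∃ c : k, ∀ x, φ x = c • x)
    [Nontrivial M] (w : W) (m : M) : homTensorEquiv hSchur w m = m ⊗ₜ[k] w := rfl

/-- `homTensorEquiv.symm ψ = coeff ψ`. -/
theorem homTensorEquiv_symm_apply (hSchur : ∀ φ : M →ₗ[S] M, ∃ c : k, ∀ x, φ x = c • x)
    [Nontrivial M] (ψ : M →ₗ[S] M ⊗[k] W) : (homTensorEquiv hSchur).symm ψ = coeff hSchur ψ := rfl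

end Summit.Ventures.HodgeRepro2.T5HomTensor

end
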